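import Literature.Analysis.FluidPDE.SelfSimilarEulerVorticityCompactSupport
import Literature.Analysis.FluidPDE.TaoEnergyLocalisationProofs
import HarnessLib

/-!
# Self-similar Euler profiles: the exterior weighted `L^p` inequality for the vorticity

Analysis/FluidPDE proofs file (theorems only; no definitions, no named facts) on the discharge path
of the named fact `Literature.Analysis.FluidPDE.chaeShvydkoy2013_vorticity_exclusion`
(Chae–Shvydkoy, ARMA 209 (2013) = arXiv:1201.6009, Thm 4.1). This file proves the finite-level
form of the FIRST half of the printed proof of Thm 4.1 — the exterior weighted `L^p` identity for
the profile vorticity equation (CS13 §4, display (4.2) integrated over the annulus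
`{R < |y| < R_j}` and the estimate after it) — for the tree's vorticity-form profiles
`IsSelfSimilarEulerVorticityProfile γ c U` (`U ∈ C²`, `div U = 0`,
`Ω + ((γ(y−c) + U)·∇)Ω = (Ω·∇)U`, `Ω = curl U`), with smooth radial weights in place of sharp
annuli (so no surface integrals are needed):

* cutoff calculus for the translated Tao cutoffs `τ(y) = θ_{2L,L}(y − c)` (`= 1` on `B̄(c, L)`,
  `= 0` off `B(c, 2L)`): the derivative is `Dτ(y) w = θ'·(−1/L²) ⟪y − c, w⟫`, it vanishes on
  `B(c, L)` and off `B̄(c, 2L)`, and `|Dτ(y)[V(y)]| ≤ (M/L²) |⟪y − c, V(y)⟫|`;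
* `IsSelfSimilarEulerVorticityProfile.integral_rpow_norm_sq_curl_weight_le` — **the exterior
  inequality at level `(ε, L)`**: for `γ > 0`, `0 < a ≤ 1`, `ε > 0`, radii `R₀ ≤ R`, `1 ≤ L`, if the
  radial transport is eventually outward (`0 ≤ ⟪V(y), y − c⟫` for `|y − c| ≥ R₀`) with quadratic
  growth (`|⟪V(y), y − c⟫| ≤ C(1 + |y − c|²)`), and the stretching is small outside `B(c, R)`
  (`|⟪Ω, DU Ω⟫| ≤ η |Ω|²` there), then with `G_ε = (|Ω|²+ε)^a − ε^a`, `φ = 1 − θ_{2R,R}(· − c)`,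
  `τ_L = θ_{2L,L}(· − c)`:
  `3γ ∫ G_ε φ τ_L ≤ 2a(1+η) ∫ φ |Ω|^{2a} + 5 M C ∫_{|y−c| ≥ L} |Ω|^{2a}`,
  provided `|Ω|^{2a} ∈ L¹` (`M` = the sup of `|smoothTransition'|`).

The limit `L → ∞`, `ε → 0` and the conclusion "`Ω` has compact support" are in the companion
`SelfSimilarEulerVorticityExterior.lean`.

## Proof of the level inequality

Integrate `div (G_ε φ τ_L V) = 3γ G_ε φ τ_L + (V·∇)(G_ε φ τ_L)` over `ℝ³`
(`integral_mul_divergence_add_eq_zero_left`, `div V = 3γ`), expand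
`(V·∇)(G_ε φ τ_L) = φ τ_L (V·∇)G_ε + G_ε τ_L (V·∇)φ + G_ε φ (V·∇)τ_L`, and bound the three terms:
`−φτ_L (V·∇)G_ε = 2a φ τ_L (f+ε)^{a−1}(f − ⟪Ω, DU Ω⟫) ≤ 2a(1+η) φ f^a` (`f = |Ω|²`; `φ` lives where
`|y−c| ≥ R`); `−G_ε τ_L (V·∇)φ ≤ 0` (`(V·∇)φ = k ⟪y−c, V⟫ ≥ 0`, `k ≥ 0`, on `|y−c| ≥ R ≥ R₀`, and
`Dφ = 0` inside `B(c,R)`); `|G_ε φ (V·∇)τ_L| ≤ f^a (M/L²) C (1 + 4L²) 𝟙_{|y−c| ≥ L} ≤ 5MC f^a 𝟙_{|y−c|≥L}`.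

## References

* D. Chae, R. Shvydkoy, ARMA 209 (2013) = arXiv:1201.6009, §4, proof of Thm 4.1 (display (4.2)
  and the following estimate). [ChaeShvydkoy2013]
* T. Tao, arXiv:1108.1165, §8 (58) (the cutoff `θ_{R,r}`; tree `taoCutoff`). [Tao2011]

## Mathlib / tree search

Reused: `taoCutoff`, `hasFDerivAt_taoCutoff`, `exists_abs_deriv_smoothTransition_le`,
`taoCutoff_eq_one_of_norm_le`, `taoCutoff_eq_zero`, `hasCompactSupport_taoCutoff`,
`contDiff_taoCutoff` (`TaoEnergyLocalisation(Proofs)`), the regularised-power calculus of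
`SelfSimilarEulerVorticityCompactSupport` (`hasFDerivAt_rpow_norm_sq_add`, …),
`integral_mul_divergence_add_eq_zero_left` (`WholeSpaceIBP`), `divergence_selfSimilarTransport`.
-/

noncomputable section

open MeasureTheory Set Filter Function Topology InnerProductSpace Metric
open scoped RealInnerProductSpace NNReal

namespace Literature.Analysis.FluidPDE

/-! ### Translated Tao cutoffs `y ↦ θ_{R', r}(y − c)` -/

section Cutoff

variable {E : Type*} [NormedAddCommGroup E]

/-- The translated cutoff `θ_{2L,L}(· − c)` (`L > 0`) equals `1` on the closed ball `B̄(c, L)`. [cite: Tao2011, §8, proof of Lemma 8.1, (58)] -/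
theorem taoCutoff_comp_sub_eq_one {L : ℝ} (hL : 0 < L) {c y : E} (hy : ‖y - c‖ ≤ L) :
    taoCutoff (2 * L) L (y - c) = 1 :=
  taoCutoff_eq_one_of_norm_le (by linarith) hL (by linarith) (by linarith)

/-- The translated cutoff `θ_{2L,L}(· − c)` (`L ≥ 0`) vanishes off the open ball `B(c, 2L)`. [cite: Tao2011, §8, proof of Lemma 8.1, (58)] -/
theorem taoCutoff_comp_sub_eq_zero {L : ℝ} (hL : 0 ≤ L) {c y : E} (hy : 2 * L ≤ ‖y - c‖) :
    taoCutoff (2 * L) L (y - c) = 0 :=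
  taoCutoff_eq_zero (by linarith) hL hy

/-- `0 ≤ θ_{2L,L}(y − c) ≤ 1`. [cite: Tao2011, §8, proof of Lemma 8.1, (58)] -/
theorem taoCutoff_comp_sub_mem_Icc (L : ℝ) (c y : E) :
    taoCutoff (2 * L) L (y - c) ∈ Icc (0 : ℝ) 1 :=
  ⟨taoCutoff_nonneg _ _ _, taoCutoff_le_one _ _ _⟩

variable [InnerProductSpace ℝ E]

/-- Derivative of the translated cutoff: `D(θ_{R',r}(· − c))(y) w = θ'(s) · (−2/(rR')) ⟪y − c, w⟫`,
`s = (R'² − |y−c|²)/(rR')`. [cite: Tao2011, §8, proof of Lemma 8.1, (58)] -/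
theorem hasFDerivAt_taoCutoff_comp_sub (R' r : ℝ) (c y : E) :
    HasFDerivAt (fun z => taoCutoff R' r (z - c))
      (deriv Real.smoothTransition ((R' ^ 2 - ‖y - c‖ ^ 2) / (r * R')) •
        ((-(2 / (r * R'))) • innerSL ℝ (y - c))) y := by
  have h2 : HasFDerivAt (fun z : E => z - c) (ContinuousLinearMap.id ℝ E) y :=
    (hasFDerivAt_id y).sub_const c
  have h := (hasFDerivAt_taoCutoff R' r (y - c)).comp y h2
  rw [ContinuousLinearMap.comp_id] at h
  exact h

/-- The derivative of the translated cutoff along a vector, as a real number. [cite: Tao2011, §8, proof of Lemma 8.1, (58)] -/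
theorem fderiv_taoCutoff_comp_sub_apply (R' r : ℝ) (c y w : E) :
    fderiv ℝ (fun z => taoCutoff R' r (z - c)) y w =
      deriv Real.smoothTransition ((R' ^ 2 - ‖y - c‖ ^ 2) / (r * R')) *
        (-(2 / (r * R')) * ⟪y - c, w⟫) := by
  rw [(hasFDerivAt_taoCutoff_comp_sub R' r c y).fderiv]
  simp only [_root_.smul_apply, innerSL_apply_apply, smul_eq_mul]

/-- The translated cutoff is smooth. [cite: Tao2011, §8, proof of Lemma 8.1, (58)] -/
theorem contDiff_taoCutoff_comp_sub (R' r : ℝ) (c : E) {n : ℕ∞} :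
    ContDiff ℝ n (fun z => taoCutoff R' r (z - c)) :=
  (contDiff_taoCutoff R' r).comp (contDiff_id.sub contDiff_const)

/-- Inside the open ball `B(c, L)` the translated cutoff is locally constant (`= 1`), so its
derivative vanishes there. [cite: Tao2011, §8, proof of Lemma 8.1, (58)] -/
theorem fderiv_taoCutoff_comp_sub_eq_zero_of_lt {L : ℝ} (hL : 0 < L) {c y : E}
    (hy : ‖y - c‖ < L) : fderiv ℝ (fun z => taoCutoff (2 * L) L (z - c)) y = 0 := by
  have hev : (fun z => taoCutoff (2 * L) L (z - c)) =ᶠ[𝓝 y] fun _ => (1 : ℝ) := by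
    have ho : IsOpen {z : E | ‖z - c‖ < L} :=
      isOpen_lt (continuous_id.sub continuous_const).norm continuous_const
    filter_upwards [ho.mem_nhds hy] with z hz
    exact taoCutoff_comp_sub_eq_one hL (le_of_lt hz)
  rw [hev.fderiv_eq, fderiv_const_apply]

/-- Off the closed ball `B̄(c, 2L)` the translated cutoff is locally constant (`= 0`), so its
derivative vanishes there. [cite: Tao2011, §8, proof of Lemma 8.1, (58)] -/
theorem fderiv_taoCutoff_comp_sub_eq_zero_of_gt {L : ℝ} (hL : 0 ≤ L) {c y : E}
    (hy : 2 * L < ‖y - c‖) : fderiv ℝ (fun z => taoCutoff (2 * L) L (z - c)) y = 0 := by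
  have hev : (fun z => taoCutoff (2 * L) L (z - c)) =ᶠ[𝓝 y] fun _ => (0 : ℝ) := by
    have ho : IsOpen {z : E | 2 * L < ‖z - c‖} :=
      isOpen_lt continuous_const (continuous_id.sub continuous_const).norm
    filter_upwards [ho.mem_nhds hy] with z hz
    exact taoCutoff_comp_sub_eq_zero hL (le_of_lt hz)
  rw [hev.fderiv_eq, fderiv_const_apply]

/-- **Derivative bound along a field.** With `M` a bound for `|smoothTransition'|` and `L > 0`:
`|D(θ_{2L,L}(· − c))(y)[w]| ≤ (M/L²) |⟪y − c, w⟫|` for all `y, w`. [cite: Tao2011, §8, proof of Lemma 8.1, (58)] -/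
theorem abs_fderiv_taoCutoff_comp_sub_apply_le {M : ℝ}
    (hM : ∀ s, |deriv Real.smoothTransition s| ≤ M) {L : ℝ} (hL : 0 < L) (c y w : E) :
    |fderiv ℝ (fun z => taoCutoff (2 * L) L (z - c)) y w| ≤ M / L ^ 2 * |⟪y - c, w⟫| := by
  rw [fderiv_taoCutoff_comp_sub_apply, abs_mul, abs_mul]
  have h2 : |(-(2 / (L * (2 * L))))| = 1 / L ^ 2 := by
    rw [abs_neg, abs_of_pos (by positivity)]
    field_simp
  rw [h2]
  calc |deriv Real.smoothTransition (((2 * L) ^ 2 - ‖y - c‖ ^ 2) / (L * (2 * L)))| *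
        (1 / L ^ 2 * |⟪y - c, w⟫|)
      ≤ M * (1 / L ^ 2 * |⟪y - c, w⟫|) :=
        mul_le_mul_of_nonneg_right (hM _) (by positivity)
    _ = M / L ^ 2 * |⟪y - c, w⟫| := by ring

/-- **Sign of the derivative of the exterior weight along an outward field.** For the exterior
weight `φ = 1 − θ_{2R,R}(· − c)`: `Dφ(y)[w] = θ'(s) (2/(2R²)) ⟪y − c, w⟫`, which is `≥ 0` whenever
`⟪y − c, w⟫ ≥ 0` (`θ' ≥ 0`). [cite: Tao2011, §8, proof of Lemma 8.1, (58)] -/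
theorem fderiv_one_sub_taoCutoff_comp_sub_apply_nonneg {R : ℝ} (hR : 0 < R) {c y w : E}
    (hw : 0 ≤ ⟪y - c, w⟫) : 0 ≤ fderiv ℝ (fun z => 1 - taoCutoff (2 * R) R (z - c)) y w := by
  rw [fderiv_const_sub, _root_.neg_apply, fderiv_taoCutoff_comp_sub_apply]
  have h1 : 0 ≤ deriv Real.smoothTransition (((2 * R) ^ 2 - ‖y - c‖ ^ 2) / (R * (2 * R))) :=
    Real.smoothTransition.monotone.deriv_nonneg
  have h2 : 0 ≤ 2 / (R * (2 * R)) * ⟪y - c, w⟫ := mul_nonneg (by positivity) hw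
  nlinarith [mul_nonneg h1 h2]

end Cutoff

/-! ### The exterior weighted inequality at level `(ε, L)` -/

namespace IsSelfSimilarEulerVorticityProfile

variable {γ : ℝ} {c : EuclideanSpace ℝ (Fin 3)}
  {U : EuclideanSpace ℝ (Fin 3) → EuclideanSpace ℝ (Fin 3)}

/-- **The exterior weighted `L^p`-type inequality at level `(ε, L)`** (CS13 §4, proof of Thm 4.1,
with smooth radial weights). Hypotheses: a vorticity-form profile (any `γ`); `0 < a ≤ 1`,
`ε > 0`; radii `0 < R₀ ≤ R`, `1 ≤ L`; eventual outward radial transport `0 ≤ ⟪V(y), y − c⟫` for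
`|y − c| ≥ R₀` and quadratic growth `|⟪V(y), y − c⟫| ≤ C (1 + |y − c|²)` (`V = γ(y−c) + U`); small
stretching `|⟪Ω, DU Ω⟫| ≤ η |Ω|²` for `|y − c| ≥ R`; `|Ω|^{2a} ∈ L¹`; `M` a bound for
`|smoothTransition'|`. Conclusion:
`3γ ∫ G_ε φ τ_L ≤ 2a(1+η) ∫ φ |Ω|^{2a} + 5MC ∫ 𝟙_{|y−c| ≥ L} |Ω|^{2a}` with
`G_ε = (|Ω|²+ε)^a − ε^a`, `φ = 1 − θ_{2R,R}(· − c)`, `τ_L = θ_{2L,L}(· − c)`. [cite: ChaeShvydkoy2013, §4, proof of Thm 4.1 (display (4.2) and the estimate following it)] -/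
theorem integral_rpow_norm_sq_curl_weight_le (h : IsSelfSimilarEulerVorticityProfile γ c U)
    {a : ℝ} (ha : 0 < a) (ha1 : a ≤ 1) {ε : ℝ} (hε : 0 < ε)
    {M : ℝ} (hM : ∀ s, |deriv Real.smoothTransition s| ≤ M)
    {R₀ R L C η : ℝ} (hR₀ : 0 < R₀) (hR : R₀ ≤ R) (hL : 1 ≤ L) (hη : 0 ≤ η)
    (hout : ∀ y, R₀ ≤ ‖y - c‖ → 0 ≤ ⟪selfSimilarTransport γ c U y, y - c⟫)
    (hgrowth : ∀ y, |⟪selfSimilarTransport γ c U y, y - c⟫| ≤ C * (1 + ‖y - c‖ ^ 2))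
    (hstretch : ∀ y, R ≤ ‖y - c‖ → |⟪curl U y, fderiv ℝ U y (curl U y)⟫| ≤ η * ‖curl U y‖ ^ 2)
    (hint : Integrable (fun y => (‖curl U y‖ ^ 2) ^ a)) :
    3 * γ * ∫ y, ((‖curl U y‖ ^ 2 + ε) ^ a - ε ^ a) *
        ((1 - taoCutoff (2 * R) R (y - c)) * taoCutoff (2 * L) L (y - c)) ≤
      (2 * a * (1 + η) * ∫ y, (1 - taoCutoff (2 * R) R (y - c)) * (‖curl U y‖ ^ 2) ^ a) +
        5 * M * C * ∫ y, Set.indicator {y | L ≤ ‖y - c‖} (fun y => (‖curl U y‖ ^ 2) ^ a) y := by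
  -- names
  set Ω : EuclideanSpace ℝ (Fin 3) → EuclideanSpace ℝ (Fin 3) := curl U with hΩdef
  set V : EuclideanSpace ℝ (Fin 3) → EuclideanSpace ℝ (Fin 3) := selfSimilarTransport γ c U
    with hVdef
  set G : EuclideanSpace ℝ (Fin 3) → ℝ := fun z => (‖Ω z‖ ^ 2 + ε) ^ a - ε ^ a with hGdef
  set φ : EuclideanSpace ℝ (Fin 3) → ℝ := fun z => 1 - taoCutoff (2 * R) R (z - c) with hφdef
  set τ : EuclideanSpace ℝ (Fin 3) → ℝ := fun z => taoCutoff (2 * L) L (z - c) with hτdef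
  set w : EuclideanSpace ℝ (Fin 3) → ℝ := fun z => φ z * τ z with hwdef
  set fa : EuclideanSpace ℝ (Fin 3) → ℝ := fun y => (‖Ω y‖ ^ 2) ^ a with hfadef
  have hRpos : 0 < R := hR₀.trans_le hR
  have hLpos : 0 < L := by linarith
  have hM0 : 0 ≤ M := (abs_nonneg _).trans (hM 0)
  have hC0 : 0 ≤ C := by
    have h1 := hgrowth c
    simp only [sub_self, inner_zero_right, abs_zero, norm_zero] at h1
    linarith
  -- regularity
  have hU2 : ContDiff ℝ 2 U := h.contDiff_velocity
  have hΩ1 : ContDiff ℝ 1 Ω := contDiff_curl (n := 1) (by exact_mod_cast hU2)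
  have hΩd : Differentiable ℝ Ω := h.differentiable_curl
  have hΩc : Continuous Ω := hΩ1.continuous
  have hUd : Differentiable ℝ U := hU2.differentiable (by norm_num)
  have hV1 : ContDiff ℝ 1 V := by
    have : ContDiff ℝ 1 fun y : EuclideanSpace ℝ (Fin 3) => γ • (y - c) + U y :=
      ((contDiff_id.sub contDiff_const).const_smul γ).add (hU2.of_le (by norm_num))
    exact this
  have hG1 : ContDiff ℝ 1 G := contDiff_rpow_norm_sq_add hΩ1 hε a
  have hφ1 : ContDiff ℝ 1 φ := contDiff_const.sub (contDiff_taoCutoff_comp_sub (2 * R) R c)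
  have hτ1 : ContDiff ℝ 1 τ := contDiff_taoCutoff_comp_sub (2 * L) L c
  have hw1 : ContDiff ℝ 1 w := hφ1.mul hτ1
  have hΘ1 : ContDiff ℝ 1 (fun z => G z * w z) := hG1.mul hw1
  -- compact support of the test function (from `τ`)
  have hτc : HasCompactSupport τ := by
    refine HasCompactSupport.of_support_subset_isCompact (isCompact_closedBall c (2 * L))
      fun z hz => ?_
    rw [mem_closedBall, dist_eq_norm]
    by_contra hcon
    exact hz (taoCutoff_comp_sub_eq_zero hLpos.le (not_le.1 hcon).le)
  have hwc : HasCompactSupport w := hτc.mul_left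
  have hΘc : HasCompactSupport (fun z => G z * w z) := hwc.mul_left
  -- pointwise facts on the weights
  have hφ_mem : ∀ z, φ z ∈ Icc (0 : ℝ) 1 := fun z => by
    have hm := taoCutoff_comp_sub_mem_Icc R c z
    exact ⟨by simp only [hφdef]; linarith [hm.2], by simp only [hφdef]; linarith [hm.1]⟩
  have hτ_mem : ∀ z, τ z ∈ Icc (0 : ℝ) 1 := fun z => taoCutoff_comp_sub_mem_Icc L c z
  have hw_mem : ∀ z, w z ∈ Icc (0 : ℝ) 1 := fun z =>
    ⟨mul_nonneg (hφ_mem z).1 (hτ_mem z).1, mul_le_one₀ (hφ_mem z).2 (hτ_mem z).1 (hτ_mem z).2⟩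
  have hφ_zero : ∀ z, ‖z - c‖ ≤ R → φ z = 0 := fun z hz => by
    simp only [hφdef, taoCutoff_comp_sub_eq_one hRpos hz, sub_self]
  have hG_mem : ∀ z, G z ∈ Icc 0 (fa z) := fun z =>
    rpow_add_sub_rpow_mem_Icc (sq_nonneg ‖Ω z‖) hε ha.le ha1
  have hfa_nn : ∀ z, 0 ≤ fa z := fun z => Real.rpow_nonneg (sq_nonneg _) _
  -- integration by parts: `∫ Θ div V + ∫ ⟪V, ∇Θ⟫ = 0`, `div V = 3γ`
  have hibp := integral_mul_divergence_add_eq_zero_left hΘ1 hV1 hΘc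
  have hdiv : ∀ y, VectorCalculus.divergence V y = 3 * γ := fun y =>
    divergence_selfSimilarTransport hUd h.divFree y
  simp_rw [hdiv] at hibp
  rw [integral_mul_const] at hibp
  -- the derivative of the test function along `V`
  have hDφ : ∀ y, DifferentiableAt ℝ φ y := fun y => hφ1.differentiable one_ne_zero y
  have hDτ : ∀ y, DifferentiableAt ℝ τ y := fun y => hτ1.differentiable one_ne_zero y
  have hDG : ∀ y, DifferentiableAt ℝ G y := fun y => hG1.differentiable one_ne_zero y
  have hDw : ∀ y, DifferentiableAt ℝ w y := fun y => hw1.differentiable one_ne_zero y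
  have hgrad : ∀ y, ⟪V y, gradient (fun z => G z * w z) y⟫ =
      w y * fderiv ℝ G y (V y) + G y * (τ y * fderiv ℝ φ y (V y) + φ y * fderiv ℝ τ y (V y)) := by
    intro y
    rw [real_inner_comm, inner_gradient_left (𝕜 := ℝ), fderiv_fun_mul (hDG y) (hDw y)]
    have hw' : fderiv ℝ w y = φ y • fderiv ℝ τ y + τ y • fderiv ℝ φ y := fderiv_fun_mul (hDφ y) (hDτ y)
    rw [hw']
    simp only [_root_.add_apply, _root_.smul_apply, smul_eq_mul]
    ring
  -- (1) the main term: `-w DG(V) ≤ 2a(1+η) φ fa`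
  have hT1 : ∀ y, -(w y * fderiv ℝ G y (V y)) ≤ 2 * a * (1 + η) * (φ y * fa y) := by
    intro y
    have hid : fderiv ℝ G y (V y) =
        2 * a * (‖Ω y‖ ^ 2 + ε) ^ (a - 1) * (⟪Ω y, fderiv ℝ U y (Ω y)⟫ - ‖Ω y‖ ^ 2) := by
      rw [hGdef, fderiv_rpow_norm_sq_add_apply hΩd hε a, hΩdef, hVdef,
        h.fderiv_curl_transport y, inner_sub_right, real_inner_self_eq_norm_sq]
    by_cases hy : ‖y - c‖ ≤ R
    · -- inside `B̄(c,R)`: `φ = 0`, both sides vanish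
      have : w y = 0 := by simp only [hwdef, hφ_zero y hy, zero_mul]
      rw [this, hφ_zero y hy]
      simp
    · have hyR : R ≤ ‖y - c‖ := (not_le.1 hy).le
      rw [hid]
      have hfe : 0 ≤ (‖Ω y‖ ^ 2 + ε) ^ (a - 1) := Real.rpow_nonneg (by positivity) _
      have hb : -(⟪Ω y, fderiv ℝ U y (Ω y)⟫ - ‖Ω y‖ ^ 2) ≤ (1 + η) * ‖Ω y‖ ^ 2 := by
        have := (abs_le.1 (hstretch y hyR)).1
        nlinarith
      have hkey : (‖Ω y‖ ^ 2 + ε) ^ (a - 1) * ‖Ω y‖ ^ 2 ≤ fa y :=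
        rpow_sub_one_mul_le_rpow (sq_nonneg _) hε ha1
      have hwle : w y ≤ φ y := by
        have := mul_le_mul_of_nonneg_left (hτ_mem y).2 (hφ_mem y).1
        simpa [hwdef] using this
      calc -(w y * (2 * a * (‖Ω y‖ ^ 2 + ε) ^ (a - 1) *
              (⟪Ω y, fderiv ℝ U y (Ω y)⟫ - ‖Ω y‖ ^ 2)))
          = w y * (2 * a * ((‖Ω y‖ ^ 2 + ε) ^ (a - 1) *
              -(⟪Ω y, fderiv ℝ U y (Ω y)⟫ - ‖Ω y‖ ^ 2))) := by ring
        _ ≤ w y * (2 * a * ((‖Ω y‖ ^ 2 + ε) ^ (a - 1) * ((1 + η) * ‖Ω y‖ ^ 2))) :=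
            mul_le_mul_of_nonneg_left (mul_le_mul_of_nonneg_left
              (mul_le_mul_of_nonneg_left hb hfe) (by positivity)) (hw_mem y).1
        _ = 2 * a * (1 + η) * (w y * ((‖Ω y‖ ^ 2 + ε) ^ (a - 1) * ‖Ω y‖ ^ 2)) := by ring
        _ ≤ 2 * a * (1 + η) * (φ y * fa y) :=
            mul_le_mul_of_nonneg_left
              (mul_le_mul hwle hkey (mul_nonneg hfe (sq_nonneg _)) (hφ_mem y).1) (by positivity)
  -- (2) the exterior-weight term has a sign: `-G τ Dφ(V) ≤ 0`
  have hT2 : ∀ y, -(G y * (τ y * fderiv ℝ φ y (V y))) ≤ 0 := by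
    intro y
    rw [neg_nonpos]
    refine mul_nonneg (hG_mem y).1 (mul_nonneg (hτ_mem y).1 ?_)
    by_cases hy : ‖y - c‖ < R
    · -- inside `B(c,R)`, `φ` is locally constant
      have h0 : fderiv ℝ φ y = 0 := by
        have := fderiv_taoCutoff_comp_sub_eq_zero_of_lt hRpos hy
        rw [hφdef, fderiv_const_sub, this, neg_zero]
      rw [h0]
      simp
    · have hyR : R₀ ≤ ‖y - c‖ := hR.trans (not_lt.1 hy)
      have hsign : 0 ≤ ⟪y - c, V y⟫ := by rw [real_inner_comm]; exact hout y hyR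
      exact fderiv_one_sub_taoCutoff_comp_sub_apply_nonneg hRpos hsign
  -- (3) the large cutoff term: `|G φ Dτ(V)| ≤ 5MC fa 𝟙_{|y−c| ≥ L}`
  have hT3 : ∀ y, -(G y * (φ y * fderiv ℝ τ y (V y))) ≤
      5 * M * C * Set.indicator {y | L ≤ ‖y - c‖} fa y := by
    intro y
    by_cases hyL : ‖y - c‖ < L
    · have h0 : fderiv ℝ τ y = 0 := fderiv_taoCutoff_comp_sub_eq_zero_of_lt hLpos hyL
      have hnot : y ∉ {y : EuclideanSpace ℝ (Fin 3) | L ≤ ‖y - c‖} := fun hmem => by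
        simp only [mem_setOf_eq] at hmem
        linarith
      rw [h0, Set.indicator_of_notMem hnot]
      simp
    · have hyL' : L ≤ ‖y - c‖ := not_lt.1 hyL
      rw [Set.indicator_of_mem (by exact hyL')]
      by_cases hy2 : 2 * L < ‖y - c‖
      · have h0 : fderiv ℝ τ y = 0 := fderiv_taoCutoff_comp_sub_eq_zero_of_gt hLpos.le hy2
        rw [h0, _root_.zero_apply, mul_zero, mul_zero, neg_zero]
        exact mul_nonneg (by positivity) (hfa_nn y)
      · have hy2' : ‖y - c‖ ≤ 2 * L := not_lt.1 hy2
        -- `|Dτ(V)| ≤ (M/L²) |⟪y−c, V⟫| ≤ (M/L²) C (1 + 4L²) ≤ 5 M C`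
        have hD : |fderiv ℝ τ y (V y)| ≤ 5 * M * C := by
          have h1 := abs_fderiv_taoCutoff_comp_sub_apply_le hM hLpos c y (V y)
          have h2 : |⟪y - c, V y⟫| ≤ C * (1 + ‖y - c‖ ^ 2) := by
            rw [real_inner_comm]; exact hgrowth y
          have h3 : C * (1 + ‖y - c‖ ^ 2) ≤ C * (1 + (2 * L) ^ 2) := by
            gcongr
          have h4 : M / L ^ 2 * (C * (1 + (2 * L) ^ 2)) ≤ 5 * M * C := by
            have hL2 : 1 ≤ L ^ 2 := by nlinarith
            rw [div_mul_eq_mul_div, div_le_iff₀ (by positivity)]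
            nlinarith [mul_nonneg hM0 hC0]
          calc |fderiv ℝ τ y (V y)| ≤ M / L ^ 2 * |⟪y - c, V y⟫| := h1
            _ ≤ M / L ^ 2 * (C * (1 + (2 * L) ^ 2)) := by
                gcongr
                exact h2.trans h3
            _ ≤ 5 * M * C := h4
        have hGφ : |G y * φ y| ≤ fa y := by
          rw [abs_mul, abs_of_nonneg (hG_mem y).1, abs_of_nonneg (hφ_mem y).1]
          calc G y * φ y ≤ fa y * 1 := mul_le_mul (hG_mem y).2 (hφ_mem y).2 (hφ_mem y).1 (hfa_nn y)
            _ = fa y := mul_one _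
        have : |G y * (φ y * fderiv ℝ τ y (V y))| ≤ fa y * (5 * M * C) := by
          rw [← mul_assoc, abs_mul]
          exact mul_le_mul hGφ hD (abs_nonneg _) (hfa_nn y)
        have := (abs_le.1 this).1
        linarith
  -- integrability of everything in sight
  have hfa_cont : Continuous fa := (hΩc.norm.pow 2).rpow_const fun _ => Or.inr ha.le
  have hφc' : Continuous φ := hφ1.continuous
  have hI1 : Integrable (fun y => φ y * fa y) := by
    refine Integrable.mono' hint (hφc'.aestronglyMeasurable.mul hfa_cont.aestronglyMeasurable)
      (ae_of_all _ fun y => ?_)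
    rw [Real.norm_eq_abs, abs_mul, abs_of_nonneg (hφ_mem y).1, abs_of_nonneg (hfa_nn y)]
    exact mul_le_of_le_one_left (hfa_nn y) (hφ_mem y).2
  have hI3 : Integrable (Set.indicator {y | L ≤ ‖y - c‖} fa) := by
    refine hint.indicator ?_
    exact (isClosed_le continuous_const (continuous_id.sub continuous_const).norm).measurableSet
  have hIgrad : Integrable (fun y => ⟪V y, gradient (fun z => G z * w z) y⟫) := by
    refine (hV1.continuous.inner (continuous_gradient_of_contDiff hΘ1))
      |>.integrable_of_hasCompactSupport (hΘc.mono' fun x hx => ?_)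
    contrapose! hx
    simp only [mem_support, not_not]
    rw [gradient_eq_zero_of_notMem_tsupport hx, inner_zero_right]
  -- assemble: `3γ ∫ G w = -∫ ⟪V, ∇Θ⟫ ≤ ∫ (bound₁ + 0 + bound₃)`
  have hptw : ∀ y, -⟪V y, gradient (fun z => G z * w z) y⟫ ≤
      2 * a * (1 + η) * (φ y * fa y) + 5 * M * C * Set.indicator {y | L ≤ ‖y - c‖} fa y := by
    intro y
    rw [hgrad y]
    have := hT1 y
    have := hT2 y
    have := hT3 y
    linarith
  have hle : -∫ y, ⟪V y, gradient (fun z => G z * w z) y⟫ ≤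
      ∫ y, (2 * a * (1 + η) * (φ y * fa y) +
        5 * M * C * Set.indicator {y | L ≤ ‖y - c‖} fa y) := by
    rw [← integral_neg]
    exact integral_mono hIgrad.neg ((hI1.const_mul _).add (hI3.const_mul _)) hptw
  rw [integral_add (hI1.const_mul _) (hI3.const_mul _), integral_const_mul, integral_const_mul]
    at hle
  have e : 3 * γ * ∫ y, G y * w y = -∫ y, ⟪V y, gradient (fun z => G z * w z) y⟫ := by linarith
  calc 3 * γ * ∫ y, G y * (φ y * τ y) = 3 * γ * ∫ y, G y * w y := by rfl
    _ = -∫ y, ⟪V y, gradient (fun z => G z * w z) y⟫ := e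
    _ ≤ (2 * a * (1 + η) * ∫ y, φ y * fa y) +
          5 * M * C * ∫ y, Set.indicator {y | L ≤ ‖y - c‖} fa y := hle

end IsSelfSimilarEulerVorticityProfile

end Literature.Analysis.FluidPDE

end
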